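import Mathlib.Probability.ProbabilityMassFunction.Constructions
import Mathlib.Analysis.SpecialFunctions.Pow.Real
import Mathlib.Algebra.BigOperators.Ring.Finset
import HarnessLib

/-!
# The low-degree likelihood ratio on the Boolean hypercube

Definition request `wi-03902` (route PneNP/PlantedClique). For a "planted" distribution `P` on
the hypercube `{0,1}^ι` (`PMF (ι → Bool)`, `ι` a finite index type, `N = |ι|`; e.g. `ι =` the edge set of `K_n` for planted clique) against the uniform "null" `Q`, the likelihood
ratio is `L = dP/dQ = 2^N · P`, and the **`D`-low-degree likelihood ratio** `L^{≤D}` is the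
orthogonal projection of `L` in `L²(Q)` onto the polynomials of degree `≤ D` (Kunisky–Wein–Bandeira,
arXiv:1907.11636, Def. 1.14 with Def. 1.8; Hopkins 2018, §2.3). On the hypercube the Walsh
characters `χ_T(x) = ∏_{i ∈ T} (-1)^{x_i}`, `T ⊆ [N]`, form an orthonormal basis of `L²(Q)` with
`deg χ_T = |T|` and `⟨L, χ_T⟩_Q = E_Q[L χ_T] = E_P[χ_T]`, so
`‖L^{≤D}‖² = Σ_{|T| ≤ D} (E_P[χ_T])²`. Everything is finite, so we DEFINE the norm by this Walsh
sum (`lowDegreeLRSq`, `lowDegreeLR = √·`) using `Finset.sum` only, and PROVE the sanity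
identities requested: `lowDegreeLR P 0 = 1`, monotonicity in `D`, and at `D = N` the full norm
`‖L‖²_{L²(Q)} = E_Q[L²] = 2^N Σ_x P(x)²` (`lowDegreeLRSq_card : lowDegreeLRSq P |ι| = lrNormSq P`,
Parseval on the cube, proved here).

## References

* D. Kunisky, A. S. Wein, A. S. Bandeira, *Notes on computational hardness of hypothesis testing:
  predictions using the low-degree likelihood ratio*, arXiv:1907.11636, Def. 1.8, Def. 1.14,
  Prop. 1.15 [KuniskyWeinBandeira2019].
* S. B. Hopkins, *Statistical inference and the sum of squares method*, PhD thesis, Cornell 2018,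
  §2.3 [Hopkins2018].
* R. O'Donnell, *Analysis of Boolean Functions* (2014), §1.4 (Walsh–Fourier expansion, Parseval).
-/

noncomputable section

namespace Literature.Probability.RandomGraphs.LowDegree

open Finset

variable {ι : Type*} [Fintype ι] [DecidableEq ι]

/-! ### Walsh characters and character means -/

/-- The `±1` value of a bit: `true ↦ -1`, `false ↦ 1` (i.e. `(-1)^b`). [O'Donnell 2014, §1.2]
[folklore] -/
def sgn (b : Bool) : ℝ := if b then -1 else 1

/-- `sgn true = -1`. [folklore] -/
@[simp] theorem sgn_true : sgn true = -1 := rfl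

/-- `sgn false = 1`. [folklore] -/
@[simp] theorem sgn_false : sgn false = 1 := rfl

/-- `sgn b ^ 2 = 1`. [folklore] -/
@[simp] theorem sgn_mul_self (b : Bool) : sgn b * sgn b = 1 := by cases b <;> simp [sgn]

/-- Distinct bits have `sgn b * sgn b' = -1`. [folklore] -/
theorem sgn_mul_sgn_of_ne {b b' : Bool} (h : b ≠ b') : sgn b * sgn b' = -1 := by
  cases b <;> cases b' <;> simp_all [sgn]

/-- The Walsh character `χ_T(x) = ∏_{i ∈ T} (-1)^{x i}`. [O'Donnell 2014, §1.4; KWB 2019, §1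
(polynomial basis on the hypercube)] [folklore] -/
def walsh (T : Finset ι) (x : ι → Bool) : ℝ := ∏ i ∈ T, sgn (x i)

omit [Fintype ι] [DecidableEq ι] in
/-- `χ_∅ = 1`. [folklore] -/
@[simp] theorem walsh_empty (x : ι → Bool) : walsh ∅ x = 1 := by simp [walsh]

/-- The character mean `E_P[χ_T] = Σ_x P(x) χ_T(x)` (`= ⟨L, χ_T⟩_{L²(Q)}` for `L = dP/dQ`).
[KWB 2019, Def. 1.8, Def. 1.14] [folklore] -/
def charMean (P : PMF (ι → Bool)) (T : Finset ι) : ℝ :=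
  ∑ x, (P x).toReal * walsh T x

/-- The total mass of a `PMF` on a finite type, in `ℝ`. [folklore] -/
theorem sum_toReal_eq_one (P : PMF (ι → Bool)) : ∑ x, (P x).toReal = 1 := by
  rw [← ENNReal.toReal_sum fun x _ => PMF.apply_ne_top P x]
  have : ∑ x, P x = 1 := by rw [← tsum_fintype (L := SummationFilter.unconditional _), PMF.tsum_coe]
  rw [this, ENNReal.toReal_one]

/-- `E_P[χ_∅] = 1`. [folklore] -/
@[simp] theorem charMean_empty (P : PMF (ι → Bool)) : charMean P ∅ = 1 := by
  simp [charMean, sum_toReal_eq_one]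

/-! ### The low-degree likelihood ratio -/

variable (ι) in
/-- The index sets of degree `≤ D`: subsets `T ⊆ ι` with `|T| ≤ D`. [folklore] -/
def degLE (D : ℕ) : Finset (Finset ι) := univ.filter fun T => T.card ≤ D

omit [DecidableEq ι] in
/-- `degLE` is monotone in `D`. [folklore] -/
theorem degLE_mono : Monotone (degLE ι) := fun _ _ h T hT => by
  simp only [degLE, mem_filter, mem_univ, true_and] at hT ⊢
  exact hT.trans h

/-- Degree `≤ 0` means `T = ∅`. [folklore] -/
@[simp] theorem degLE_zero : degLE ι 0 = {∅} := by
  ext T; simp [degLE]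

omit [DecidableEq ι] in
/-- Every `T ⊆ ι` has degree `≤ |ι|`. [folklore] -/
@[simp] theorem degLE_card : degLE ι (Fintype.card ι) = univ := by
  ext T
  simp only [degLE, mem_filter, mem_univ, true_and, iff_true]
  exact T.card_le_univ

/-- **`‖L^{≤D}‖²`**, the squared `D`-low-degree likelihood ratio of `P` against the uniform
distribution on `{0,1}^ι`: `Σ_{|T| ≤ D} (E_P[χ_T])²` (Walsh–Parseval form of the squared
`L²(Q)`-norm of the projection of `L = dP/dQ` onto degree-`≤ D` polynomials).
[KWB 2019, Def. 1.14 (`L_n^{≤D}`) with Def. 1.8; Hopkins 2018, §2.3] [cite: KuniskyWeinBandeira2019, Def. 1.14] -/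
def lowDegreeLRSq (P : PMF (ι → Bool)) (D : ℕ) : ℝ := ∑ T ∈ degLE ι D, charMean P T ^ 2

/-- **`‖L^{≤D}‖`**, the `D`-low-degree likelihood ratio norm (the value of the optimisation
problem of KWB Prop. 1.15). [KWB 2019, Def. 1.14, Prop. 1.15] [cite: KuniskyWeinBandeira2019, Def. 1.14] -/
def lowDegreeLR (P : PMF (ι → Bool)) (D : ℕ) : ℝ := Real.sqrt (lowDegreeLRSq P D)

/-- `‖L‖²_{L²(Q)} = E_Q[L²] = 2^N Σ_x P(x)²` for `L = dP/dQ = 2^N P`, `Q` uniform, `N = |ι|`.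
[KWB 2019, Def. 1.8] [folklore] -/
def lrNormSq (P : PMF (ι → Bool)) : ℝ := 2 ^ Fintype.card ι * ∑ x, (P x).toReal ^ 2

/-! ### The requested identities -/

/-- `lowDegreeLRSq` is nonnegative. [folklore] -/
theorem lowDegreeLRSq_nonneg (P : PMF (ι → Bool)) (D : ℕ) : 0 ≤ lowDegreeLRSq P D :=
  sum_nonneg fun _ _ => sq_nonneg _

/-- **`‖L^{≤0}‖² = 1`** (only the constant character). [KWB 2019, §1 (remark after Def. 1.14)]
[folklore] -/
@[simp] theorem lowDegreeLRSq_zero (P : PMF (ι → Bool)) : lowDegreeLRSq P 0 = 1 := by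
  simp [lowDegreeLRSq]

/-- **`‖L^{≤0}‖ = 1`.** [folklore] -/
@[simp] theorem lowDegreeLR_zero (P : PMF (ι → Bool)) : lowDegreeLR P 0 = 1 := by
  simp [lowDegreeLR]

/-- **Monotonicity in the degree**: `D ≤ D' → ‖L^{≤D}‖² ≤ ‖L^{≤D'}‖²`. [KWB 2019, §1] [folklore] -/
theorem lowDegreeLRSq_mono (P : PMF (ι → Bool)) : Monotone (lowDegreeLRSq P) :=
  fun _ _ h => sum_le_sum_of_subset_of_nonneg (degLE_mono h) fun _ _ _ => sq_nonneg _

/-- Monotonicity of `‖L^{≤D}‖` in `D`. [folklore] -/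
theorem lowDegreeLR_mono (P : PMF (ι → Bool)) : Monotone (lowDegreeLR P) :=
  fun _ _ h => Real.sqrt_le_sqrt (lowDegreeLRSq_mono P h)

/-- Hence `1 ≤ ‖L^{≤D}‖²` for every `D`. [folklore] -/
theorem one_le_lowDegreeLRSq (P : PMF (ι → Bool)) (D : ℕ) : 1 ≤ lowDegreeLRSq P D := by
  simpa using lowDegreeLRSq_mono P (Nat.zero_le D)

omit [DecidableEq ι] in
/-- Orthogonality of Walsh characters summed over the index: `Σ_T χ_T(x) χ_T(y) = 2^N [x = y]`.
[O'Donnell 2014, §1.4] [folklore] -/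
theorem sum_walsh_mul_walsh (x y : ι → Bool) :
    ∑ T, walsh T x * walsh T y = if x = y then (2 : ℝ) ^ Fintype.card ι else 0 := by
  have hT : ∀ T : Finset ι, walsh T x * walsh T y = ∏ i ∈ T, (sgn (x i) * sgn (y i)) := by
    intro T; rw [walsh, walsh, ← prod_mul_distrib]
  simp_rw [hT]
  rw [← Finset.powerset_univ, ← Finset.prod_one_add]
  split_ifs with hxy
  · subst hxy
    simp only [sgn_mul_self]
    norm_num
  · obtain ⟨i, hi⟩ : ∃ i, x i ≠ y i := by
      by_contra h
      push Not at h
      exact hxy (funext h)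
    exact prod_eq_zero (mem_univ i) (by rw [sgn_mul_sgn_of_ne hi]; norm_num)

/-- **Parseval at full degree**: `‖L^{≤N}‖² = ‖L‖² = 2^N Σ_x P(x)²`.
[KWB 2019, Def. 1.8 / Def. 1.14 (`D = N`); O'Donnell 2014, §1.4 (Parseval)] [folklore] -/
theorem lowDegreeLRSq_card (P : PMF (ι → Bool)) :
    lowDegreeLRSq P (Fintype.card ι) = lrNormSq P := by
  simp only [lowDegreeLRSq, degLE_card, lrNormSq, charMean]
  calc ∑ T, (∑ x, (P x).toReal * walsh T x) ^ 2
      = ∑ T, ∑ x, ∑ y, (P x).toReal * (P y).toReal * (walsh T x * walsh T y) := by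
        refine sum_congr rfl fun T _ => ?_
        rw [sq, sum_mul_sum]
        refine sum_congr rfl fun x _ => sum_congr rfl fun y _ => ?_
        ring
    _ = ∑ x, ∑ y, (P x).toReal * (P y).toReal * ∑ T, walsh T x * walsh T y := by
        rw [sum_comm]
        refine sum_congr rfl fun x _ => ?_
        rw [sum_comm]
        refine sum_congr rfl fun y _ => ?_
        rw [mul_sum]
    _ = ∑ x, (P x).toReal * (P x).toReal * 2 ^ Fintype.card ι := by
        refine sum_congr rfl fun x _ => ?_
        simp_rw [sum_walsh_mul_walsh]
        simp
    _ = 2 ^ Fintype.card ι * ∑ x, (P x).toReal ^ 2 := by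
        rw [mul_sum]
        refine sum_congr rfl fun x _ => ?_
        ring

/-- Hence `‖L^{≤N}‖ = √(E_Q[L²])`. [folklore] -/
theorem lowDegreeLR_card (P : PMF (ι → Bool)) :
    lowDegreeLR P (Fintype.card ι) = Real.sqrt (lrNormSq P) := by
  rw [lowDegreeLR, lowDegreeLRSq_card]

end Literature.Probability.RandomGraphs.LowDegree

end
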